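import Summits.Ventures.YMGap.RobustBall.LocalSourceMassGap
import Summits.Ventures.YMGap.RobustBall.LocalSourceResponseBall
import Summits.Ventures.YMGap.RobustBall.LocalSourceAnalytic
import Summits.Ventures.YMGap.RobustBall.UniformRateStrongCoupling
import Summits.Ventures.YMGap.RobustBall.UniformMassGapS
import HarnessLib

/-!
# Venture YMGap, track ROBUST-BALL (Y2) — UNIFORMLY ON THE LOOP-ACTION NORM BALL: one more loop of ANY strength keeps one state,
# a `C¹`/real-analytic response, an exponentially small susceptibility and a mass gap at least `m/2`

HONEST FRAMING. WHAT THIS IS: a venture file (cell `pub-ymgap`, track Y2 ROBUST-BALL, seat rb-p1, theorems only): the local-source package read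
UNIFORMLY on the tier-2 loop-action norm ball (`LoopActionMember.lean`: generic Wilson-type actions `Σ_i c_i Re tr U_{γ_i}/N`, any index set with
finite carrier fibres, `‖c‖_w ≤ ε`) of a uniform tier-2 row `UniformMassGapOnBallZdS d N β (2ε) ε w m A` — not just at the Wilson point
(`LocalSourceWilson.lean`).  For EVERY member `(γ, c)` of the ball and ONE MORE closed walk `w₀` with ANY real coupling `t`:
* `loopBall_singleLoop_hasDerivAt_of_uniform` — for every selection `ν t` of DLR states of the member plus `t · Re tr U_{w₀}/N` and every bounded
  measurable `F`: `d/dt ∫F dν_t = −cov_{ν_t}(F, Re tr U_{w₀}/N)` at every real `t` (and `ν 0` is the member's unique state);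
* `loopBall_singleLoop_analyticAt_of_uniform` — `t ↦ ∫F dν_t` is real-analytic on `ℝ`;
* `loopBall_singleLoop_susceptibility_le_of_uniform` — `|d/dt|_{t=0} ∫F dν_t| ≤ A n² e^{−m d(Λ_F, w₀)} (K_F √N|w₀| + ‖F‖₂‖Re tr U_{w₀}/N‖₂)`;
* `loopBall_singleLoop_massGap_of_uniform` — every DLR state of the member plus the loop clusters between ANY two Lipschitz cylinders at rate
  `m/2`, constant `A n² e^{2|t|} e^{m|w₀|} (…)` (`A ≥ 1`);
instantiated on the `SU(2)` `ℤ⁴` loop ball of radius `1/10` at the maximal weight (`UniformRateStrongCoupling.su2_uniformLoopBall_rate`):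
`su2_loopBall_rate_row` (`0 < β_W < 1/8`: `UniformMassGapOnBallZdS 4 2 (β_W/4) (1/5) (1/10) (log(1/(8β_W))) (log(1/(8β_W))) 16`),
`su2_loopBall_singleLoop_hasDerivAt`, `su2_loopBall_singleLoop_analyticAt`, `su2_loopBall_singleLoop_susceptibility_le`,
★ `su2_loopBall_singleLoop_massGap` — for every loop action with `‖c‖_{log(1/(8β_W))} ≤ 1/10` and every further loop of any strength, the
perturbed state clusters at rate `(1/2) log(1/(8β_W))`; and for EVERY `N ≥ 2` on the hypothesis-free loop ball `‖c‖_{log(6/5)} ≤ 1/40` at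
't Hooft `1/64` (rate `log(6/5)`, constant `8N`; `UniformMassGapS.suN_uniformRowS_1_64`): `suN_loopBall_rate_row`,
`suN_loopBall_singleLoop_hasDerivAt / _analyticAt / _massGap`.  (One state: `LocalSourceLoops.hasUniqueGibbsMeasure_loopBall_add_loops`.)
WHAT THIS IS NOT: rates are comparison lower bounds; `m/2` is bookkeeping; lattice strong coupling; nothing about the continuum limit or a
Clay-sense mass gap.
-/

noncomputable section

open MeasureTheory Function Finset Real ProbabilityTheory
open scoped NNReal
open Literature.Probability.LatticeModels
open Literature.MathematicalPhysics.QuantumLattice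
open Literature.MathematicalPhysics.QuantumFieldTheory hiding ZdEdge Site

namespace Summit.Ventures.YMGap.RobustBall

variable {d N : ℕ}

/-! ### Generic: a member of the loop ball plus one loop of any strength -/

section Generic

variable {ι : Type} {β w ε m A : ℝ} {γ : ι → ZdLoop d} {c : ι → ℝ}

/-- The tier-2 data of the one-loop source with coupling `t`: continuity, own-link dependence, support family and catalogue. -/
private theorem singleLoopS_data {x : Literature.Probability.LatticeModels.Site d} (w₀ : (zdGraph d).Walk x x) (t : ℝ) :
    (∀ X, Continuous (loopFamilyAction (d := d) N (fun _ : Unit => (⟨x, w₀⟩ : ZdLoop d)) (fun _ => t) X)) ∧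
    (∀ X, DependsOn (loopFamilyAction (d := d) N (fun _ : Unit => (⟨x, w₀⟩ : ZdLoop d)) (fun _ => t) X) (↑X : Set (ZdEdge d))) ∧
    (loopFamilyAction (d := d) N (fun _ : Unit => (⟨x, w₀⟩ : ZdLoop d)) fun _ => t).IsSupportedBy
      (loopSupp (fun _ : Unit => (⟨x, w₀⟩ : ZdLoop d))) ∧
    (∀ Λ, loopSupp (fun _ : Unit => (⟨x, w₀⟩ : ZdLoop d)) Λ ⊆
      (Finset.univ : Finset Unit).image fun i => walkEdges ((fun _ : Unit => (⟨x, w₀⟩ : ZdLoop d)) i).walk) := by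
  classical
  have hV := memBallZd_loopFamilyAction_fintype (N := N) (fun _ : Unit => (⟨x, w₀⟩ : ZdLoop d)) fun _ => t
  exact ⟨hV.continuous, hV.dependsOn, hV.supportedBy, fun Λ => Finset.image_subset_image (Finset.subset_univ _)⟩

/-- The catalogue of the one-loop source is `{links of w₀}`. -/
private theorem singleLoopS_image {x : Literature.Probability.LatticeModels.Site d} (w₀ : (zdGraph d).Walk x x) :
    (Finset.univ : Finset Unit).image (fun i => walkEdges ((fun _ : Unit => (⟨x, w₀⟩ : ZdLoop d)) i).walk) = {walkEdges w₀} := by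
  classical
  ext X
  simp only [Finset.mem_image, Finset.mem_univ, true_and, Finset.mem_singleton]
  exact ⟨fun ⟨_, h⟩ => h.symm, fun h => ⟨(), h.symm⟩⟩

/-- The family `t ↦ member + loop with coupling t` is `W + t • V₁`. -/
private theorem loopBall_family (x : Literature.Probability.LatticeModels.Site d) (w₀ : (zdGraph d).Walk x x) (t : ℝ) :
    loopFamilyAction (d := d) N γ c + loopFamilyAction (d := d) N (fun _ : Unit => (⟨x, w₀⟩ : ZdLoop d)) (fun _ => t) =
      loopFamilyAction (d := d) N γ c + t • loopFamilyAction (d := d) N (fun _ : Unit => (⟨x, w₀⟩ : ZdLoop d)) fun _ => (1 : ℝ) := by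
  rw [← loopFamilyAction_smul]
  simp only [mul_one]

/-- **FEYNMAN–HELLMANN UNIFORMLY ON THE LOOP BALL.** For a uniform tier-2 row `UniformMassGapOnBallZdS d N β (2ε) ε w m A`, every loop action
`(γ, c)` with finite carrier fibres and `‖c‖_w ≤ ε`, one more closed walk `w₀`, every selection `ν t` of DLR states of the member plus
`t · Re tr U_{w₀}/N`, and every bounded measurable `F`: `ν 0` is a DLR state of the member and
`d/dt ∫ F dν_t |_{t=b} = −cov_{ν_b}(F, Re tr U_{w₀}/N)` at every real `b`. -/
theorem loopBall_singleLoop_hasDerivAt_of_uniform (hrow : UniformMassGapOnBallZdS d N β (2 * ε) ε w m A)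
    (hfin : ∀ X, {i | walkEdges (γ i).walk = X}.Finite) (hc : LoopNormLE w γ c ε)
    {x : Literature.Probability.LatticeModels.Site d} (w₀ : (zdGraph d).Walk x x)
    {ν : ℝ → Measure (LGConfig d (SUN N))}
    (hν : ∀ t, ν t ∈ perturbedGibbsMeasuresS (d := d) (fundamentalRep (Fin N)) (N * β)
      (loopFamilyAction (d := d) N γ c + loopFamilyAction (d := d) N (fun _ : Unit => (⟨x, w₀⟩ : ZdLoop d)) (fun _ => t)))
    {F : LGConfig d (SUN N) → ℝ} (hFm : Measurable F) {C : ℝ} (hFb : ∀ U, |F U| ≤ C) (b : ℝ) :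
    ν 0 ∈ perturbedGibbsMeasuresS (d := d) (fundamentalRep (Fin N)) (N * β) (loopFamilyAction (d := d) N γ c) ∧
      HasDerivAt (fun t => ∫ U, F U ∂(ν t)) (-cov[F, loopTerm (d := d) N 1 w₀; ν b]) b := by
  classical
  have hW : MemBallZdS (2 * ε) ε w (loopFamilyAction (d := d) N γ c) := memBallZdS_loopFamilyAction hfin hc
  obtain ⟨hVc, hVdep, hVs, hT⟩ := singleLoopS_data (N := N) w₀ (1 : ℝ)
  have hν' : ∀ t, ν t ∈ perturbedGibbsMeasuresS (d := d) (fundamentalRep (Fin N)) (N * β)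
      (loopFamilyAction (d := d) N γ c + t • loopFamilyAction (d := d) N (fun _ : Unit => (⟨x, w₀⟩ : ZdLoop d)) fun _ => (1 : ℝ)) := by
    intro t
    rw [← loopBall_family x w₀ t]
    exact hν t
  obtain ⟨h0, -, hder⟩ := hasDerivAt_integral_of_uniformMassGapOnBallZdS hrow hW hVc hVdep hVs hT hν' hFm hFb b
  have hH : (fun U : LGConfig d (SUN N) => ∑ A ∈ (Finset.univ : Finset Unit).image
      (fun i => walkEdges ((fun _ : Unit => (⟨x, w₀⟩ : ZdLoop d)) i).walk),
      loopFamilyAction (d := d) N (fun _ : Unit => (⟨x, w₀⟩ : ZdLoop d)) (fun _ => (1 : ℝ)) A U) = loopTerm (d := d) N 1 w₀ :=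
    funext fun U => sum_singleLoop_source w₀ U
  rw [hH] at hder
  exact ⟨h0, hder⟩

/-- **REAL-ANALYTICITY UNIFORMLY ON THE LOOP BALL**: `t ↦ ∫ F dν_t` is real-analytic at every `t₀ ∈ ℝ`. -/
theorem loopBall_singleLoop_analyticAt_of_uniform (hrow : UniformMassGapOnBallZdS d N β (2 * ε) ε w m A)
    (hfin : ∀ X, {i | walkEdges (γ i).walk = X}.Finite) (hc : LoopNormLE w γ c ε)
    {x : Literature.Probability.LatticeModels.Site d} (w₀ : (zdGraph d).Walk x x)
    {ν : ℝ → Measure (LGConfig d (SUN N))}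
    (hν : ∀ t, ν t ∈ perturbedGibbsMeasuresS (d := d) (fundamentalRep (Fin N)) (N * β)
      (loopFamilyAction (d := d) N γ c + loopFamilyAction (d := d) N (fun _ : Unit => (⟨x, w₀⟩ : ZdLoop d)) (fun _ => t)))
    {F : LGConfig d (SUN N) → ℝ} (hFm : Measurable F) {C : ℝ} (hFb : ∀ U, |F U| ≤ C) (t₀ : ℝ) :
    AnalyticAt ℝ (fun t => ∫ U, F U ∂(ν t)) t₀ := by
  classical
  have hW : MemBallZdS (2 * ε) ε w (loopFamilyAction (d := d) N γ c) := memBallZdS_loopFamilyAction hfin hc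
  obtain ⟨hVc, hVdep, hVs, hT⟩ := singleLoopS_data (N := N) w₀ (1 : ℝ)
  have hν' : ∀ t, ν t ∈ perturbedGibbsMeasuresS (d := d) (fundamentalRep (Fin N)) (N * β)
      (loopFamilyAction (d := d) N γ c + t • loopFamilyAction (d := d) N (fun _ : Unit => (⟨x, w₀⟩ : ZdLoop d)) fun _ => (1 : ℝ)) := by
    intro t
    rw [← loopBall_family x w₀ t]
    exact hν t
  exact analyticAt_integral_of_uniformMassGapOnBallZdS hrow hW hVc hVdep hVs hT hν' hFm hFb t₀

/-- **THE SUSCEPTIBILITY TO ONE MORE LOOP IS EXPONENTIALLY SMALL IN THE SEPARATION, UNIFORMLY ON THE LOOP BALL**: for every member, every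
selection `ν t`, and every Lipschitz cylinder `F` on `Λ_F` disjoint from the links of `w₀` (`|Λ_F|, |links w₀| ≤ n`):
`|d/dt|_{t=0} ∫ F dν_t| ≤ A n² e^{−m d(Λ_F, w₀)} (K_F · √N |w₀| + ‖F‖₂ ‖Re tr U_{w₀}/N‖₂)` (norms in the member's state `ν 0`). -/
theorem loopBall_singleLoop_susceptibility_le_of_uniform (hrow : UniformMassGapOnBallZdS d N β (2 * ε) ε w m A)
    (hfin : ∀ X, {i | walkEdges (γ i).walk = X}.Finite) (hc : LoopNormLE w γ c ε)
    {x : Literature.Probability.LatticeModels.Site d} (w₀ : (zdGraph d).Walk x x)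
    {ν : ℝ → Measure (LGConfig d (SUN N))}
    (hν : ∀ t, ν t ∈ perturbedGibbsMeasuresS (d := d) (fundamentalRep (Fin N)) (N * β)
      (loopFamilyAction (d := d) N γ c + loopFamilyAction (d := d) N (fun _ : Unit => (⟨x, w₀⟩ : ZdLoop d)) (fun _ => t)))
    {n : ℕ} {F : LGConfig d (SUN N) → ℝ} {ΛF : Finset (ZdEdge d)} {KF : ℝ≥0}
    (hF : IsLipschitzCylinder (fundamentalRep (Fin N)) F ΛF KF) (hΛF : ΛF.card ≤ n) (hwn : (walkEdges w₀).card ≤ n)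
    (hdisj : Disjoint ΛF (walkEdges w₀)) :
    ∃ χ : ℝ, HasDerivAt (fun t => ∫ U, F U ∂(ν t)) χ 0 ∧
      |χ| ≤ A * (n : ℝ) ^ 2 * Real.exp (-m * setDistEdges ΛF (walkEdges w₀)) *
        ((KF : ℝ) * (|(1 : ℝ)| * Real.sqrt N * w₀.length) +
          Real.sqrt (∫ U, F U ^ 2 ∂(ν 0)) * Real.sqrt (∫ U, loopTerm (d := d) N 1 w₀ U ^ 2 ∂(ν 0))) := by
  classical
  have hW : MemBallZdS (2 * ε) ε w (loopFamilyAction (d := d) N γ c) := memBallZdS_loopFamilyAction hfin hc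
  obtain ⟨hVc, hVdep, hVs, hT⟩ := singleLoopS_data (N := N) w₀ (1 : ℝ)
  have hν' : ∀ t, ν t ∈ perturbedGibbsMeasuresS (d := d) (fundamentalRep (Fin N)) (N * β)
      (loopFamilyAction (d := d) N γ c + t • loopFamilyAction (d := d) N (fun _ : Unit => (⟨x, w₀⟩ : ZdLoop d)) fun _ => (1 : ℝ)) := by
    intro t
    rw [← loopBall_family x w₀ t]
    exact hν t
  obtain ⟨h0, hcl, hder⟩ := hasDerivAt_integral_of_uniformMassGapOnBallZdS hrow hW hVc hVdep hVs hT hν' hF.measurable hF.abs_le 0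
  have himg := singleLoopS_image (d := d) w₀
  refine ⟨_, hder, ?_⟩
  rw [abs_neg, himg]
  set Kc : Finset (ZdEdge d) → ℝ≥0 := fun _ => ⟨|(1 : ℝ)| * Real.sqrt N * w₀.length, by positivity⟩ with hKc
  have hKcc : ∀ X, (Kc X : ℝ) = |(1 : ℝ)| * Real.sqrt N * w₀.length := fun X => by rw [hKc]; rfl
  have key := abs_cov_hamiltonian_le_of_perturbedClusteringS hcl h0 (n := n) hF hΛF
    (V := loopFamilyAction (d := d) N (fun _ : Unit => (⟨x, w₀⟩ : ZdLoop d)) fun _ => (1 : ℝ))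
    (T := ({walkEdges w₀} : Finset (Finset (ZdEdge d)))) (K := Kc) (fun X hX => by
      rw [Finset.mem_singleton] at hX
      subst hX
      rw [loopFamilyAction_single_apply]
      exact isLipschitzCylinder_loopTerm (N := N) 1 w₀)
    (fun X hX => by rw [Finset.mem_singleton] at hX; subst hX; exact hwn)
    (fun X hX => by rw [Finset.mem_singleton] at hX; subst hX; exact hdisj)
  rw [Finset.sum_singleton, loopFamilyAction_single_apply, hKcc (walkEdges w₀)] at key
  refine key.trans (le_of_eq ?_)
  ring

/-- ★ **THE MASS GAP SURVIVES ONE MORE LOOP OF ANY STRENGTH, UNIFORMLY ON THE LOOP BALL** (`A ≥ 1`): for every member `(γ, c)` and every DLR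
state `ν` of the member plus `t · Re tr U_{w₀}/N`, all Lipschitz cylinders `F`, `G` on disjoint link sets with
`|Λ_F ∪ links w₀|, |Λ_G ∪ links w₀| ≤ n`:
`|cov_ν(F, G)| ≤ A n² e^{2|t|} e^{m|w₀|} e^{−(m/2) d(Λ_F, Λ_G)} (K_F K_G + 2 (|t|√N|w₀|)(M_F K_G + M_G K_F) + 2 M_F M_G)`. -/
theorem loopBall_singleLoop_massGap_of_uniform (hrow : UniformMassGapOnBallZdS d N β (2 * ε) ε w m A) (hA : 1 ≤ A)
    (hfin : ∀ X, {i | walkEdges (γ i).walk = X}.Finite) (hc : LoopNormLE w γ c ε)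
    {x : Literature.Probability.LatticeModels.Site d} (w₀ : (zdGraph d).Walk x x) (t : ℝ)
    {ν : Measure (LGConfig d (SUN N))}
    (hν : ν ∈ perturbedGibbsMeasuresS (d := d) (fundamentalRep (Fin N)) (N * β)
      (loopFamilyAction (d := d) N γ c + loopFamilyAction (d := d) N (fun _ : Unit => (⟨x, w₀⟩ : ZdLoop d)) (fun _ => t)))
    {n : ℕ} {F G : LGConfig d (SUN N) → ℝ} {ΛF ΛG : Finset (ZdEdge d)} {KF KG MF MG : ℝ≥0}
    (hF : IsLipschitzCylinder (fundamentalRep (Fin N)) F ΛF KF) (hMF : ∀ U, |F U| ≤ MF)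
    (hG : IsLipschitzCylinder (fundamentalRep (Fin N)) G ΛG KG) (hMG : ∀ U, |G U| ≤ MG)
    (hn₁ : (ΛF ∪ walkEdges w₀).card ≤ n) (hn₂ : (ΛG ∪ walkEdges w₀).card ≤ n) (hdisj : Disjoint ΛF ΛG) :
    |cov[F, G; ν]| ≤ A * (n : ℝ) ^ 2 * exp (2 * |t|) * exp (m * (2 * w₀.length) / 2) *
        exp (-(m / 2) * setDistEdges ΛF ΛG) *
      ((KF : ℝ) * KG + 2 * (|t| * Real.sqrt N * w₀.length) * (MF * KG + MG * KF) + 2 * MF * MG) := by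
  classical
  have hW : MemBallZdS (2 * ε) ε w (loopFamilyAction (d := d) N γ c) := memBallZdS_loopFamilyAction hfin hc
  obtain ⟨hVc, hVdep, hVs, hT⟩ := singleLoopS_data (N := N) w₀ t
  have himg := singleLoopS_image (d := d) w₀
  set Kc : Finset (ZdEdge d) → ℝ≥0 := fun _ => ⟨|t| * Real.sqrt N * w₀.length, by positivity⟩ with hKc
  have hKcc : ∀ X, (Kc X : ℝ) = |t| * Real.sqrt N * w₀.length := fun X => by rw [hKc]; rfl
  have hVL : ∀ X ∈ (Finset.univ : Finset Unit).image (fun i => walkEdges ((fun _ : Unit => (⟨x, w₀⟩ : ZdLoop d)) i).walk),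
      IsLipschitzCylinder (fundamentalRep (Fin N)) (loopFamilyAction (d := d) N (fun _ : Unit => (⟨x, w₀⟩ : ZdLoop d)) (fun _ => t) X)
        X (Kc X) := by
    intro X hX
    rw [himg, Finset.mem_singleton] at hX
    subst hX
    rw [loopFamilyAction_single_apply]
    exact isLipschitzCylinder_loopTerm (N := N) t w₀
  have hS : ∀ X ∈ (Finset.univ : Finset Unit).image (fun i => walkEdges ((fun _ : Unit => (⟨x, w₀⟩ : ZdLoop d)) i).walk),
      X ⊆ walkEdges w₀ := by
    intro X hX
    rw [himg, Finset.mem_singleton] at hX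
    exact hX.le
  have hB : ∀ U, |∑ X ∈ (Finset.univ : Finset Unit).image (fun i => walkEdges ((fun _ : Unit => (⟨x, w₀⟩ : ZdLoop d)) i).walk),
      loopFamilyAction (d := d) N (fun _ : Unit => (⟨x, w₀⟩ : ZdLoop d)) (fun _ => t) X U| ≤ |t| := by
    intro U
    rw [himg, Finset.sum_singleton, loopFamilyAction_single_apply]
    exact abs_loopTerm_le w₀ U
  have hδ : ∀ s ∈ walkEdges w₀, ∀ s' ∈ walkEdges w₀, ‖s.1 - s'.1‖ ≤ 2 * (w₀.length : ℝ) := fun s hs s' hs' =>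
    norm_sub_le_two_mul_length_of_mem_walkEdges w₀ hs hs'
  have key := abs_cov_le_halfRate_of_uniformMassGapOnBallZdS_add hrow hA hW hVc hVdep hVs hT hVL hS hB (by positivity) hδ hν
    hF hMF hG hMG hn₁ hn₂ hdisj
  have hsum : ((∑ X ∈ (Finset.univ : Finset Unit).image (fun i => walkEdges ((fun _ : Unit => (⟨x, w₀⟩ : ZdLoop d)) i).walk),
      Kc X : ℝ≥0) : ℝ) = |t| * Real.sqrt N * w₀.length := by
    rw [himg, Finset.sum_singleton]; exact hKcc (walkEdges w₀)
  rw [hsum] at key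
  exact key

end Generic

/-! ### `SU(2)`, `d = 4`: the loop ball of radius `1/10` at the maximal weight `log(1/(8β_W))`, `0 < β_W < 1/8` -/

section SU2

variable {ι : Type} {βW : ℝ} {γ : ι → ZdLoop 4} {c : ι → ℝ}

/-- **THE TIER-2 ROW BEHIND THE `SU(2)` LOOP BALL OF RADIUS `1/10`** (`UniformRateStrongCoupling.su2_uniformLoopBall_rate`'s row, restated):
for `0 < β_W < 1/8`, `UniformMassGapOnBallZdS 4 2 (β_W/4) (2·(1/10)) (1/10) (log(1/(8β_W))) (log(1/(8β_W))) 16`. -/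
theorem su2_loopBall_rate_row (h0 : 0 < βW) (h : βW < 1 / 8) :
    UniformMassGapOnBallZdS 4 2 (βW / 4) (2 * (1 / 10)) (1 / 10) (Real.log (1 / (8 * βW))) (Real.log (1 / (8 * βW))) 16 := by
  have hq : 1 < 1 / (8 * βW) := by rw [lt_div_iff₀ (by positivity)]; linarith
  refine su2_uniformRowBS hq h0.le (by linarith) (by norm_num) (by norm_num) ?_
  have e : 3 * (1732051 / 1000000 : ℝ) * βW * (1 / (8 * βW)) = 3 * (1732051 / 1000000) / 8 := by
    field_simp
  rw [e]
  norm_num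

/-- **`SU(2)` loop ball, Feynman–Hellmann**: `‖c‖_{log(1/(8β_W))} ≤ 1/10`, one more loop `w₀` of any strength. -/
theorem su2_loopBall_singleLoop_hasDerivAt (h0 : 0 < βW) (h : βW < 1 / 8)
    (hfin : ∀ X, {i | walkEdges (γ i).walk = X}.Finite) (hc : LoopNormLE (Real.log (1 / (8 * βW))) γ c (1 / 10))
    {x : Literature.Probability.LatticeModels.Site 4} (w₀ : (zdGraph 4).Walk x x)
    {ν : ℝ → Measure (LGConfig 4 (SUN 2))}
    (hν : ∀ t, ν t ∈ perturbedGibbsMeasuresS (d := 4) (fundamentalRep (Fin 2)) (2 * (βW / 4))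
      (loopFamilyAction (d := 4) 2 γ c + loopFamilyAction (d := 4) 2 (fun _ : Unit => (⟨x, w₀⟩ : ZdLoop 4)) (fun _ => t)))
    {F : LGConfig 4 (SUN 2) → ℝ} (hFm : Measurable F) {C : ℝ} (hFb : ∀ U, |F U| ≤ C) (b : ℝ) :
    HasDerivAt (fun t => ∫ U, F U ∂(ν t)) (-cov[F, loopTerm (d := 4) 2 1 w₀; ν b]) b :=
  (loopBall_singleLoop_hasDerivAt_of_uniform (su2_loopBall_rate_row h0 h) hfin hc w₀ hν hFm hFb b).2

/-- **`SU(2)` loop ball, real-analyticity in the extra coupling.** -/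
theorem su2_loopBall_singleLoop_analyticAt (h0 : 0 < βW) (h : βW < 1 / 8)
    (hfin : ∀ X, {i | walkEdges (γ i).walk = X}.Finite) (hc : LoopNormLE (Real.log (1 / (8 * βW))) γ c (1 / 10))
    {x : Literature.Probability.LatticeModels.Site 4} (w₀ : (zdGraph 4).Walk x x)
    {ν : ℝ → Measure (LGConfig 4 (SUN 2))}
    (hν : ∀ t, ν t ∈ perturbedGibbsMeasuresS (d := 4) (fundamentalRep (Fin 2)) (2 * (βW / 4))
      (loopFamilyAction (d := 4) 2 γ c + loopFamilyAction (d := 4) 2 (fun _ : Unit => (⟨x, w₀⟩ : ZdLoop 4)) (fun _ => t)))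
    {F : LGConfig 4 (SUN 2) → ℝ} (hFm : Measurable F) {C : ℝ} (hFb : ∀ U, |F U| ≤ C) (t₀ : ℝ) :
    AnalyticAt ℝ (fun t => ∫ U, F U ∂(ν t)) t₀ :=
  loopBall_singleLoop_analyticAt_of_uniform (su2_loopBall_rate_row h0 h) hfin hc w₀ hν hFm hFb t₀

/-- **`SU(2)` loop ball, exponentially small susceptibility**: rate `log(1/(8β_W))`, constant `16 n²`. -/
theorem su2_loopBall_singleLoop_susceptibility_le (h0 : 0 < βW) (h : βW < 1 / 8)
    (hfin : ∀ X, {i | walkEdges (γ i).walk = X}.Finite) (hc : LoopNormLE (Real.log (1 / (8 * βW))) γ c (1 / 10))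
    {x : Literature.Probability.LatticeModels.Site 4} (w₀ : (zdGraph 4).Walk x x)
    {ν : ℝ → Measure (LGConfig 4 (SUN 2))}
    (hν : ∀ t, ν t ∈ perturbedGibbsMeasuresS (d := 4) (fundamentalRep (Fin 2)) (2 * (βW / 4))
      (loopFamilyAction (d := 4) 2 γ c + loopFamilyAction (d := 4) 2 (fun _ : Unit => (⟨x, w₀⟩ : ZdLoop 4)) (fun _ => t)))
    {n : ℕ} {F : LGConfig 4 (SUN 2) → ℝ} {ΛF : Finset (ZdEdge 4)} {KF : ℝ≥0}
    (hF : IsLipschitzCylinder (fundamentalRep (Fin 2)) F ΛF KF) (hΛF : ΛF.card ≤ n) (hwn : (walkEdges w₀).card ≤ n)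
    (hdisj : Disjoint ΛF (walkEdges w₀)) :
    ∃ χ : ℝ, HasDerivAt (fun t => ∫ U, F U ∂(ν t)) χ 0 ∧
      |χ| ≤ 16 * (n : ℝ) ^ 2 * Real.exp (-Real.log (1 / (8 * βW)) * setDistEdges ΛF (walkEdges w₀)) *
        ((KF : ℝ) * (|(1 : ℝ)| * Real.sqrt (2 : ℕ) * w₀.length) +
          Real.sqrt (∫ U, F U ^ 2 ∂(ν 0)) * Real.sqrt (∫ U, loopTerm (d := 4) 2 1 w₀ U ^ 2 ∂(ν 0))) :=
  loopBall_singleLoop_susceptibility_le_of_uniform (su2_loopBall_rate_row h0 h) hfin hc w₀ hν hF hΛF hwn hdisj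

/-- ★ **`SU(2)` LOOP BALL: ONE MORE LOOP OF ANY STRENGTH DOES NOT CLOSE THE MASS GAP** — for `0 < β_W < 1/8`, every loop action with finite carrier
fibres and `‖c‖_{log(1/(8β_W))} ≤ 1/10`, every further closed walk `w₀` with any real coupling `t`, every DLR state `ν` of the perturbed action:
`|cov_ν(F, G)| ≤ 16 n² e^{2|t|} (8β_W)^{−|w₀|} e^{−(1/2)log(1/(8β_W)) d(Λ_F, Λ_G)} (K_F K_G + 2 (|t|√2|w₀|)(M_F K_G + M_G K_F) + 2 M_F M_G)`. -/
theorem su2_loopBall_singleLoop_massGap (h0 : 0 < βW) (h : βW < 1 / 8)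
    (hfin : ∀ X, {i | walkEdges (γ i).walk = X}.Finite) (hc : LoopNormLE (Real.log (1 / (8 * βW))) γ c (1 / 10))
    {x : Literature.Probability.LatticeModels.Site 4} (w₀ : (zdGraph 4).Walk x x) (t : ℝ)
    {ν : Measure (LGConfig 4 (SUN 2))}
    (hν : ν ∈ perturbedGibbsMeasuresS (d := 4) (fundamentalRep (Fin 2)) (2 * (βW / 4))
      (loopFamilyAction (d := 4) 2 γ c + loopFamilyAction (d := 4) 2 (fun _ : Unit => (⟨x, w₀⟩ : ZdLoop 4)) (fun _ => t)))
    {n : ℕ} {F G : LGConfig 4 (SUN 2) → ℝ} {ΛF ΛG : Finset (ZdEdge 4)} {KF KG MF MG : ℝ≥0}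
    (hF : IsLipschitzCylinder (fundamentalRep (Fin 2)) F ΛF KF) (hMF : ∀ U, |F U| ≤ MF)
    (hG : IsLipschitzCylinder (fundamentalRep (Fin 2)) G ΛG KG) (hMG : ∀ U, |G U| ≤ MG)
    (hn₁ : (ΛF ∪ walkEdges w₀).card ≤ n) (hn₂ : (ΛG ∪ walkEdges w₀).card ≤ n) (hdisj : Disjoint ΛF ΛG) :
    |cov[F, G; ν]| ≤ 16 * (n : ℝ) ^ 2 * exp (2 * |t|) * exp (Real.log (1 / (8 * βW)) * (2 * w₀.length) / 2) *
        exp (-(Real.log (1 / (8 * βW)) / 2) * setDistEdges ΛF ΛG) *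
      ((KF : ℝ) * KG + 2 * (|t| * Real.sqrt (2 : ℕ) * w₀.length) * (MF * KG + MG * KF) + 2 * MF * MG) :=
  loopBall_singleLoop_massGap_of_uniform (su2_loopBall_rate_row h0 h) (by norm_num) hfin hc w₀ t hν hF hMF hG hMG hn₁ hn₂ hdisj

end SU2

/-! ### Every `N ≥ 2`, `d = 4`, 't Hooft `1/64`: the loop ball of radius `1/40` at weight `log(6/5)`, rate `log(6/5)`, constant `8N` -/

section SUN

variable {ι : Type} {γ : ι → ZdLoop 4} {c : ι → ℝ}

/-- **The all-`N` tier-2 row behind the loop ball of radius `1/40`** (`UniformMassGapS.suN_uniformMassGapOnLoopBall_1_64`'s row, restated):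
`UniformMassGapOnBallZdS 4 N (1/64) (2·(1/40)) (1/40) (log(6/5)) (log(6/5)) (8N)`. -/
theorem suN_loopBall_rate_row (hN : 2 ≤ N) :
    UniformMassGapOnBallZdS 4 N (1 / 64) (2 * (1 / 40)) (1 / 40) (Real.log (6 / 5)) (Real.log (6 / 5)) (8 * N) :=
  (suN_uniformRowS_1_64 hN).mono (a' := 2 * (1 / 40)) (Λ' := 1 / 40) (by norm_num) (by norm_num)
    (Real.log_pos (by norm_num)) le_rfl le_rfl (by positivity)

/-- **Every `N ≥ 2`, loop ball `‖c‖_{log(6/5)} ≤ 1/40` at 't Hooft `1/64`: Feynman–Hellmann for one more loop of any strength.** -/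
theorem suN_loopBall_singleLoop_hasDerivAt (hN : 2 ≤ N)
    (hfin : ∀ X, {i | walkEdges (γ i).walk = X}.Finite) (hc : LoopNormLE (Real.log (6 / 5)) γ c (1 / 40))
    {x : Literature.Probability.LatticeModels.Site 4} (w₀ : (zdGraph 4).Walk x x)
    {ν : ℝ → Measure (LGConfig 4 (SUN N))}
    (hν : ∀ t, ν t ∈ perturbedGibbsMeasuresS (d := 4) (fundamentalRep (Fin N)) (N * (1 / 64 : ℝ))
      (loopFamilyAction (d := 4) N γ c + loopFamilyAction (d := 4) N (fun _ : Unit => (⟨x, w₀⟩ : ZdLoop 4)) (fun _ => t)))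
    {F : LGConfig 4 (SUN N) → ℝ} (hFm : Measurable F) {C : ℝ} (hFb : ∀ U, |F U| ≤ C) (b : ℝ) :
    HasDerivAt (fun t => ∫ U, F U ∂(ν t)) (-cov[F, loopTerm (d := 4) N 1 w₀; ν b]) b :=
  (loopBall_singleLoop_hasDerivAt_of_uniform (suN_loopBall_rate_row hN) hfin hc w₀ hν hFm hFb b).2

/-- **Every `N ≥ 2`, loop ball: real-analytic response.** -/
theorem suN_loopBall_singleLoop_analyticAt (hN : 2 ≤ N)
    (hfin : ∀ X, {i | walkEdges (γ i).walk = X}.Finite) (hc : LoopNormLE (Real.log (6 / 5)) γ c (1 / 40))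
    {x : Literature.Probability.LatticeModels.Site 4} (w₀ : (zdGraph 4).Walk x x)
    {ν : ℝ → Measure (LGConfig 4 (SUN N))}
    (hν : ∀ t, ν t ∈ perturbedGibbsMeasuresS (d := 4) (fundamentalRep (Fin N)) (N * (1 / 64 : ℝ))
      (loopFamilyAction (d := 4) N γ c + loopFamilyAction (d := 4) N (fun _ : Unit => (⟨x, w₀⟩ : ZdLoop 4)) (fun _ => t)))
    {F : LGConfig 4 (SUN N) → ℝ} (hFm : Measurable F) {C : ℝ} (hFb : ∀ U, |F U| ≤ C) (t₀ : ℝ) :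
    AnalyticAt ℝ (fun t => ∫ U, F U ∂(ν t)) t₀ :=
  loopBall_singleLoop_analyticAt_of_uniform (suN_loopBall_rate_row hN) hfin hc w₀ hν hFm hFb t₀

/-- ★ **Every `N ≥ 2`, loop ball: ONE MORE LOOP OF ANY STRENGTH DOES NOT CLOSE THE MASS GAP** — rate `(1/2)log(6/5)`, constant
`8N n² e^{2|t|} (6/5)^{|w₀|} (…)`. -/
theorem suN_loopBall_singleLoop_massGap (hN : 2 ≤ N)
    (hfin : ∀ X, {i | walkEdges (γ i).walk = X}.Finite) (hc : LoopNormLE (Real.log (6 / 5)) γ c (1 / 40))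
    {x : Literature.Probability.LatticeModels.Site 4} (w₀ : (zdGraph 4).Walk x x) (t : ℝ)
    {ν : Measure (LGConfig 4 (SUN N))}
    (hν : ν ∈ perturbedGibbsMeasuresS (d := 4) (fundamentalRep (Fin N)) (N * (1 / 64 : ℝ))
      (loopFamilyAction (d := 4) N γ c + loopFamilyAction (d := 4) N (fun _ : Unit => (⟨x, w₀⟩ : ZdLoop 4)) (fun _ => t)))
    {n : ℕ} {F G : LGConfig 4 (SUN N) → ℝ} {ΛF ΛG : Finset (ZdEdge 4)} {KF KG MF MG : ℝ≥0}
    (hF : IsLipschitzCylinder (fundamentalRep (Fin N)) F ΛF KF) (hMF : ∀ U, |F U| ≤ MF)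
    (hG : IsLipschitzCylinder (fundamentalRep (Fin N)) G ΛG KG) (hMG : ∀ U, |G U| ≤ MG)
    (hn₁ : (ΛF ∪ walkEdges w₀).card ≤ n) (hn₂ : (ΛG ∪ walkEdges w₀).card ≤ n) (hdisj : Disjoint ΛF ΛG) :
    |cov[F, G; ν]| ≤ 8 * N * (n : ℝ) ^ 2 * exp (2 * |t|) * exp (Real.log (6 / 5) * (2 * w₀.length) / 2) *
        exp (-(Real.log (6 / 5) / 2) * setDistEdges ΛF ΛG) *
      ((KF : ℝ) * KG + 2 * (|t| * Real.sqrt N * w₀.length) * (MF * KG + MG * KF) + 2 * MF * MG) := by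
  have hA : (1 : ℝ) ≤ 8 * N := by
    have : (2 : ℝ) ≤ N := by exact_mod_cast hN
    linarith
  exact loopBall_singleLoop_massGap_of_uniform (suN_loopBall_rate_row hN) hA hfin hc w₀ t hν hF hMF hG hMG hn₁ hn₂ hdisj

end SUN


end Summit.Ventures.YMGap.RobustBall

end
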